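import Summits.CriticalPhenomena.PercolationContinuityZ3.Theorems.PercNearOneGluingNoHeavyLowerTailAntitheticPrivTop
import HarnessLib

/-!
# `NoHeavyLowerTail` (stmt-CriticalPhenomena-4575) — antithetic cluster pairs: **A PENDANT EDGE AT THE SOURCE IS TRANSPARENT FOR THE TOP
# EVENT** (prim-hp-2 gen 75, HOME/THEOREM-PRIV.md §2 — CONJECTURE P1 for a pendant private neighbour)

Support file (`--supports stmt-CriticalPhenomena-4575`, prim-hp-2 gen 75).  No definitions, no named facts, no sorries; standard axioms.
Notation of …AntitheticPrivTop (`X T`, `Y T` the red / blue clusters of `s` in the edge set `E`; `K`-form kernels: twisted-monotone, super-odd).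
Let `a ∉ {s, P}` be a vertex meeting NO pair of `E`, and `E' = E ∪ {sa}` (a pendant private neighbour of the source).  On a colouring `T`:
if `sa` is red then `X_{E'} T = X_E T ∪ {a}`, `Y_{E'} T = Y_E T`; if `sa` is blue then `X_{E'} T = X_E T`, `Y_{E'} T = Y_E T ∪ {a}`
(`SourcePendant.cluster_insert_of_mem / _of_not_mem`).  Pairing `T` with `T △ {sa}` gives, on the top event of `P` (the same for `E` and `E'`),
  `K₁K₂(X ∪ a, Y) + K₁K₂(X, Y ∪ a) ≥ ½ K̃₁K̃₂(X, Y)`,  `K̃(A,B) := K(A ∪ a, B) + K(A, B ∪ a)` (again twisted-monotone and super-odd),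
because `2(αβ + γδ) − (α+γ)(β+δ) = (α−γ)(β−δ) ≥ 0`.  Hence:
* `Antithetic.SourcePendant.top_sum_nonneg_insert` — if the top event of `(E, s, P)` is nonnegative for ALL `K`-form kernel pairs, then so is
  the top event of `(E ∪ {sa}, s, P)`.  With THEOREM TWD (…AntitheticDomTopAll) this settles CONJECTURE P1 (HOME/THEOREM-PRIV.md) for pendant
  private neighbours; the genuine case is a private neighbour with further neighbours.
[cite: VandenbergHaggstromKahn2005, §1 p. 6 ("Harris' inequality"), §1 p. 3 (open cluster `C_s`)]
-/

noncomputable section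

namespace Summit.CriticalPhenomena.PercolationContinuityZ3.Theorems

open Literature.Probability.Percolation
open scoped Classical

namespace Antithetic

namespace SourcePendant

variable {V : Type*}

section Clusters

variable {E : Set (Sym2 V)} {s a : V}

/-- Adding the red pendant pair `sa` (`a` isolated in `E`) adds exactly `a` to the cluster of `s`. [this work] -/
theorem cluster_insert_of_mem (haE : ∀ e ∈ E, a ∉ e) (hsa : s ≠ a) {W : Set (Sym2 V)} (hW : s(s, a) ∈ W) :
    openCluster (W ∩ insert s(s, a) E) s = insert a (openCluster (W ∩ E) s) := by
  apply Set.Subset.antisymm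
  · refine TwoStage.Fan.cluster_subset_of_closed (Set.mem_insert_of_mem a (mem_openCluster_self _ s)) fun u w hu huw => ?_
    obtain ⟨⟨hWuw, hE'⟩, hne⟩ := (openGraph_adj _ u w).1 huw
    rcases Set.mem_insert_iff.1 hE' with he | he
    · have hw : w ∈ s(s, a) := by rw [← he]; exact Sym2.mem_mk_right u w
      rcases Sym2.mem_iff.1 hw with hws | hwa
      · rw [hws]; exact Set.mem_insert_of_mem a (mem_openCluster_self _ _)
      · rw [hwa]; exact Set.mem_insert a _
    · have hua : u ≠ a := fun h => haE _ he (h ▸ Sym2.mem_mk_left u w)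
      rcases Set.mem_insert_iff.1 hu with h | h
      · exact absurd h hua
      · exact Set.mem_insert_of_mem a (Twin.mem_red_of_pair h hWuw he hne)
  · intro x hx
    rcases Set.mem_insert_iff.1 hx with hxa | hx
    · rw [hxa]
      exact Twin.mem_red_of_pair (E := insert s(s, a) E) (mem_openCluster_self _ s) hW (Set.mem_insert _ _) hsa
    · exact Freeze.openCluster_mono (Set.inter_subset_inter_right W (Set.subset_insert _ E)) s hx

/-- A blue pendant pair `sa` does not change the red cluster of `s`. [this work] -/
theorem cluster_insert_of_not_mem {W : Set (Sym2 V)} (hW : s(s, a) ∉ W) :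
    openCluster (W ∩ insert s(s, a) E) s = openCluster (W ∩ E) s := by
  have h : W ∩ insert s(s, a) E = W ∩ E := by
    ext x
    simp only [Set.mem_inter_iff, Set.mem_insert_iff]
    constructor
    · rintro ⟨hx, rfl | hxE⟩
      · exact absurd hx hW
      · exact ⟨hx, hxE⟩
    · rintro ⟨hx, hxE⟩
      exact ⟨hx, Or.inr hxE⟩
  rw [h]

/-- Colourings differing only in a pair outside `E` have the same clusters. [this work] -/
theorem cluster_congr_of_not_mem {e : Sym2 V} (he : e ∉ E) {W W' : Set (Sym2 V)} (h : ∀ x, x ≠ e → (x ∈ W ↔ x ∈ W')) :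
    openCluster (W ∩ E) s = openCluster (W' ∩ E) s := by
  have hWW : W ∩ E = W' ∩ E := by
    ext x
    simp only [Set.mem_inter_iff]
    constructor
    · rintro ⟨hx, hxE⟩
      exact ⟨(h x fun hxe => he (hxe ▸ hxE)).1 hx, hxE⟩
    · rintro ⟨hx, hxE⟩
      exact ⟨(h x fun hxe => he (hxe ▸ hxE)).2 hx, hxE⟩
  rw [hWW]

end Clusters

/-- The elementary inequality behind the pairing `T ↔ T △ {sa}`. [this work] -/
theorem pair_ineq {α β γ δ : ℝ} (h1 : γ ≤ α) (h2 : δ ≤ β) : (α + γ) * (β + δ) ≤ 2 * (α * β + γ * δ) := by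
  nlinarith [mul_nonneg (sub_nonneg.2 h1) (sub_nonneg.2 h2)]

variable [Fintype V]

/-- **A pendant edge at the source is transparent for the top event (`K`-form).**  `a ∉ {s, P}` meets no pair of `E`.  If
`Σ_{T : P ∈ X_E T ∖ Y_E T} K₁K₂ ≥ 0` for ALL super-odd twisted-monotone `K₁, K₂`, then the same holds for `E ∪ {sa}`. [this work] -/
theorem top_sum_nonneg_insert (E : Set (Sym2 V)) (s P a : V) (haE : ∀ e ∈ E, a ∉ e) (hsa : s ≠ a) (hPa : P ≠ a)
    (hE : ∀ K₁ K₂ : Set V → Set V → ℝ,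
      (∀ ⦃A A' B B' : Set V⦄, A ⊆ A' → B' ⊆ B → K₁ A B ≤ K₁ A' B') → (∀ A B, 0 ≤ K₁ A B + K₁ B A) →
      (∀ ⦃A A' B B' : Set V⦄, A ⊆ A' → B' ⊆ B → K₂ A B ≤ K₂ A' B') → (∀ A B, 0 ≤ K₂ A B + K₂ B A) →
      0 ≤ ∑ T ∈ Finset.univ.filter (fun T : Set (Sym2 V) => P ∈ openCluster (T ∩ E) s ∧ P ∉ openCluster (Tᶜ ∩ E) s),
        K₁ (openCluster (T ∩ E) s) (openCluster (Tᶜ ∩ E) s) * K₂ (openCluster (T ∩ E) s) (openCluster (Tᶜ ∩ E) s))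
    {K₁ K₂ : Set V → Set V → ℝ}
    (hK₁ : ∀ ⦃A A' B B' : Set V⦄, A ⊆ A' → B' ⊆ B → K₁ A B ≤ K₁ A' B') (hso₁ : ∀ A B, 0 ≤ K₁ A B + K₁ B A)
    (hK₂ : ∀ ⦃A A' B B' : Set V⦄, A ⊆ A' → B' ⊆ B → K₂ A B ≤ K₂ A' B') (hso₂ : ∀ A B, 0 ≤ K₂ A B + K₂ B A) :
    0 ≤ ∑ T ∈ Finset.univ.filter (fun T : Set (Sym2 V) =>
        P ∈ openCluster (T ∩ insert s(s, a) E) s ∧ P ∉ openCluster (Tᶜ ∩ insert s(s, a) E) s),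
      K₁ (openCluster (T ∩ insert s(s, a) E) s) (openCluster (Tᶜ ∩ insert s(s, a) E) s) *
        K₂ (openCluster (T ∩ insert s(s, a) E) s) (openCluster (Tᶜ ∩ insert s(s, a) E) s) := by
  -- notation
  let e : Sym2 V := s(s, a)
  let E' : Set (Sym2 V) := insert e E
  let X : Set (Sym2 V) → Set V := fun T => openCluster (T ∩ E) s
  let Y : Set (Sym2 V) → Set V := fun T => openCluster (Tᶜ ∩ E) s
  let X' : Set (Sym2 V) → Set V := fun T => openCluster (T ∩ E') s
  let Y' : Set (Sym2 V) → Set V := fun T => openCluster (Tᶜ ∩ E') s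
  let top : Set (Sym2 V) → Prop := fun T => P ∈ X T ∧ P ∉ Y T
  let top' : Set (Sym2 V) → Prop := fun T => P ∈ X' T ∧ P ∉ Y' T
  let f' : Set (Sym2 V) → ℝ := fun T => K₁ (X' T) (Y' T) * K₂ (X' T) (Y' T)
  let g₁ : Set (Sym2 V) → ℝ := fun T => K₁ (insert a (X T)) (Y T) * K₂ (insert a (X T)) (Y T)
  let g₂ : Set (Sym2 V) → ℝ := fun T => K₁ (X T) (insert a (Y T)) * K₂ (X T) (insert a (Y T))
  let Kt₁ : Set V → Set V → ℝ := fun A B => K₁ (insert a A) B + K₁ A (insert a B)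
  let Kt₂ : Set V → Set V → ℝ := fun A B => K₂ (insert a A) B + K₂ A (insert a B)
  let φ : Set (Sym2 V) → ℝ := fun T => Kt₁ (X T) (Y T) * Kt₂ (X T) (Y T)
  show 0 ≤ ∑ T ∈ Finset.univ.filter top', f' T
  have heE : e ∉ E := fun h => haE _ h (Sym2.mem_mk_right s a)
  -- clusters in `E'` versus `E`
  have hX'_in : ∀ T : Set (Sym2 V), e ∈ T → X' T = insert a (X T) := fun T hT => cluster_insert_of_mem haE hsa hT
  have hY'_in : ∀ T : Set (Sym2 V), e ∈ T → Y' T = Y T := fun T hT =>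
    cluster_insert_of_not_mem (W := Tᶜ) (fun h => h hT)
  have hX'_out : ∀ T : Set (Sym2 V), e ∉ T → X' T = X T := fun T hT => cluster_insert_of_not_mem hT
  have hY'_out : ∀ T : Set (Sym2 V), e ∉ T → Y' T = insert a (Y T) := fun T hT =>
    cluster_insert_of_mem (W := Tᶜ) haE hsa hT
  -- clusters in `E` ignore the colour of `e`
  have hX_ins : ∀ T : Set (Sym2 V), X (insert e T) = X T := fun T =>
    cluster_congr_of_not_mem heE fun x hx => by
      simp only [Set.mem_insert_iff]; exact ⟨fun h => h.resolve_left hx, Or.inr⟩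
  have hY_ins : ∀ T : Set (Sym2 V), Y (insert e T) = Y T := fun T =>
    cluster_congr_of_not_mem heE fun x hx => by
      simp only [Set.mem_compl_iff, Set.mem_insert_iff, not_or]; exact ⟨fun h => h.2, fun h => ⟨hx, h⟩⟩
  have hX_del : ∀ T : Set (Sym2 V), X (T \ {e}) = X T := fun T =>
    cluster_congr_of_not_mem heE fun x hx => by
      simp only [Set.mem_sdiff, Set.mem_singleton_iff]; exact ⟨fun h => h.1, fun h => ⟨h, hx⟩⟩
  have hY_del : ∀ T : Set (Sym2 V), Y (T \ {e}) = Y T := fun T =>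
    cluster_congr_of_not_mem heE fun x hx => by
      simp only [Set.mem_compl_iff, Set.mem_sdiff, Set.mem_singleton_iff, not_and, not_not]
      exact ⟨fun h hxT => absurd (h hxT) hx, fun h hxT => absurd hxT h⟩
  have hPa' : ∀ S : Set V, (P ∈ insert a S ↔ P ∈ S) := fun S => by
    simp only [Set.mem_insert_iff]; exact ⟨fun h => h.resolve_left hPa, Or.inr⟩
  have htop'_in : ∀ T : Set (Sym2 V), e ∈ T → (top' T ↔ top T) := fun T hT => by
    simp only [top', top]; rw [hX'_in T hT, hY'_in T hT, hPa']
  have htop'_out : ∀ T : Set (Sym2 V), e ∉ T → (top' T ↔ top T) := fun T hT => by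
    simp only [top', top]; rw [hX'_out T hT, hY'_out T hT, hPa']
  -- (1) split by the colour of `e`
  rw [← Finset.sum_filter_add_sum_filter_not _ (fun T => e ∈ T), Finset.filter_filter, Finset.filter_filter]
  -- (2) the red half, reindexed by `T ↦ T ∖ {e}`
  have h1 : ∑ T ∈ Finset.univ.filter (fun T => top' T ∧ e ∈ T), f' T = ∑ T ∈ Finset.univ.filter (fun T => top T ∧ e ∉ T), g₁ T := by
    refine Finset.sum_nbij' (fun T => T \ {e}) (fun T => insert e T) ?_ ?_ ?_ ?_ ?_
    · intro T hT
      simp only [Finset.mem_filter, Finset.mem_univ, true_and] at hT ⊢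
      refine ⟨?_, fun h => h.2 rfl⟩
      have ht : top T := (htop'_in T hT.2).1 hT.1
      simp only [top]; rw [hX_del, hY_del]; exact ht
    · intro T hT
      simp only [Finset.mem_filter, Finset.mem_univ, true_and] at hT ⊢
      refine ⟨(htop'_in _ (Set.mem_insert e T)).2 ?_, Set.mem_insert e T⟩
      simp only [top]; rw [hX_ins, hY_ins]; exact hT.1
    · intro T hT
      simp only [Finset.mem_filter, Finset.mem_univ, true_and] at hT
      ext x
      simp only [Set.mem_insert_iff, Set.mem_sdiff, Set.mem_singleton_iff]
      constructor
      · rintro (rfl | ⟨h, -⟩)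
        · exact hT.2
        · exact h
      · intro h
        by_cases hx : x = e
        · exact Or.inl hx
        · exact Or.inr ⟨h, hx⟩
    · intro T hT
      simp only [Finset.mem_filter, Finset.mem_univ, true_and] at hT
      ext x
      simp only [Set.mem_sdiff, Set.mem_insert_iff, Set.mem_singleton_iff]
      constructor
      · rintro ⟨rfl | h, hne⟩
        · exact absurd rfl hne
        · exact h
      · intro h
        exact ⟨Or.inr h, fun hx => hT.2 (hx ▸ h)⟩
    · intro T hT
      simp only [Finset.mem_filter, Finset.mem_univ, true_and] at hT
      simp only [f', g₁]
      rw [hX'_in T hT.2, hY'_in T hT.2, hX_del, hY_del]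
  -- (3) the blue half, same index set
  have h2 : ∑ T ∈ Finset.univ.filter (fun T => top' T ∧ e ∉ T), f' T = ∑ T ∈ Finset.univ.filter (fun T => top T ∧ e ∉ T), g₂ T := by
    have hfilt : Finset.univ.filter (fun T => top' T ∧ e ∉ T) = Finset.univ.filter (fun T => top T ∧ e ∉ T) := by
      ext T
      simp only [Finset.mem_filter, Finset.mem_univ, true_and]
      constructor
      · rintro ⟨ht, hT⟩; exact ⟨(htop'_out T hT).1 ht, hT⟩
      · rintro ⟨ht, hT⟩; exact ⟨(htop'_out T hT).2 ht, hT⟩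
    rw [hfilt]
    refine Finset.sum_congr rfl fun T hT => ?_
    have hT' : e ∉ T := ((Finset.mem_filter.1 hT).2).2
    simp only [f', g₂]
    rw [hX'_out T hT', hY'_out T hT']
  rw [h1, h2, ← Finset.sum_add_distrib]
  -- (4) pairing inequality: g₁ + g₂ ≥ ½ φ
  have hXsub : ∀ T : Set (Sym2 V), X T ⊆ insert a (X T) := fun T => Set.subset_insert _ _
  have hYsub : ∀ T : Set (Sym2 V), Y T ⊆ insert a (Y T) := fun T => Set.subset_insert _ _
  have hpt : ∀ T : Set (Sym2 V), φ T ≤ 2 * (g₁ T + g₂ T) := fun T =>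
    pair_ineq (hK₁ (hXsub T) (hYsub T)) (hK₂ (hXsub T) (hYsub T))
  have hφ : 0 ≤ ∑ T ∈ Finset.univ.filter (fun T => top T ∧ e ∉ T), φ T := by
    -- `φ` ignores the colour of `e`: the two halves of the top event carry the same sum, and the whole is ≥ 0 by `hE` for `K̃`
    have hKt₁ : ∀ ⦃A A' B B' : Set V⦄, A ⊆ A' → B' ⊆ B → Kt₁ A B ≤ Kt₁ A' B' := fun A A' B B' hA hB =>
      add_le_add (hK₁ (Set.insert_subset_insert hA) hB) (hK₁ hA (Set.insert_subset_insert hB))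
    have hKt₂ : ∀ ⦃A A' B B' : Set V⦄, A ⊆ A' → B' ⊆ B → Kt₂ A B ≤ Kt₂ A' B' := fun A A' B B' hA hB =>
      add_le_add (hK₂ (Set.insert_subset_insert hA) hB) (hK₂ hA (Set.insert_subset_insert hB))
    have hsot₁ : ∀ A B, 0 ≤ Kt₁ A B + Kt₁ B A := fun A B => by
      have h1 := hso₁ (insert a A) B
      have h2 := hso₁ A (insert a B)
      simp only [Kt₁]; linarith
    have hsot₂ : ∀ A B, 0 ≤ Kt₂ A B + Kt₂ B A := fun A B => by
      have h1 := hso₂ (insert a A) B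
      have h2 := hso₂ A (insert a B)
      simp only [Kt₂]; linarith
    have hall : 0 ≤ ∑ T ∈ Finset.univ.filter top, φ T := hE Kt₁ Kt₂ hKt₁ hsot₁ hKt₂ hsot₂
    have hsplit := Finset.sum_filter_add_sum_filter_not (Finset.univ.filter top) (fun T => e ∈ T) φ
    rw [Finset.filter_filter, Finset.filter_filter] at hsplit
    have hhalf : ∑ T ∈ Finset.univ.filter (fun T => top T ∧ e ∈ T), φ T = ∑ T ∈ Finset.univ.filter (fun T => top T ∧ e ∉ T), φ T := by
      refine Finset.sum_nbij' (fun T => T \ {e}) (fun T => insert e T) ?_ ?_ ?_ ?_ ?_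
      · intro T hT
        simp only [Finset.mem_filter, Finset.mem_univ, true_and] at hT ⊢
        refine ⟨?_, fun h => h.2 rfl⟩
        simp only [top]; rw [hX_del, hY_del]; exact hT.1
      · intro T hT
        simp only [Finset.mem_filter, Finset.mem_univ, true_and] at hT ⊢
        refine ⟨?_, Set.mem_insert e T⟩
        simp only [top]; rw [hX_ins, hY_ins]; exact hT.1
      · intro T hT
        simp only [Finset.mem_filter, Finset.mem_univ, true_and] at hT
        ext x
        simp only [Set.mem_insert_iff, Set.mem_sdiff, Set.mem_singleton_iff]
        constructor
        · rintro (rfl | ⟨h, -⟩)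
          · exact hT.2
          · exact h
        · intro h
          by_cases hx : x = e
          · exact Or.inl hx
          · exact Or.inr ⟨h, hx⟩
      · intro T hT
        simp only [Finset.mem_filter, Finset.mem_univ, true_and] at hT
        ext x
        simp only [Set.mem_sdiff, Set.mem_insert_iff, Set.mem_singleton_iff]
        constructor
        · rintro ⟨rfl | h, hne⟩
          · exact absurd rfl hne
          · exact h
        · intro h
          exact ⟨Or.inr h, fun hx => hT.2 (hx ▸ h)⟩
      · intro T hT
        simp only [φ]
        rw [hX_del, hY_del]
    rw [hhalf] at hsplit
    linarith
  have hle : ∑ T ∈ Finset.univ.filter (fun T => top T ∧ e ∉ T), φ T ≤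
      ∑ T ∈ Finset.univ.filter (fun T => top T ∧ e ∉ T), 2 * (g₁ T + g₂ T) := Finset.sum_le_sum fun T _ => hpt T
  rw [← Finset.mul_sum] at hle
  linarith

end SourcePendant

end Antithetic

end Summit.CriticalPhenomena.PercolationContinuityZ3.Theorems
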